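import Literature.AlgebraicGeometry.Resolution.InseparableLocalUniformizationDefect
import HarnessLib

/-!
# Inseparable local uniformization: Step 0 of the proof of Thm. 4.1.1 for the descent shape

Topic: `Literature/AlgebraicGeometry/Resolution`. M. Temkin, *Inseparable local uniformization*,
J. Algebra 373 (2013) 65–119 = arXiv:0804.1554v3. Step 0 of the proof of Thm. 4.1.1 (p. 47):
"if `F/K` is a finite purely inseparable extension then `X′ = Nr_F(X)` is an affine model of `F°`
and for any normal affine refinement `Y′ = Spec(B)` of `X′`, the scheme `Y = Spec(B ∩ K)` is an
affine refinement of `X` satisfying `Nr_F(Y) →~ Y′`. Indeed, `B^{pⁿ} ⊂ B ∩ K` for a large `n`,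
hence `Nr_F(B ∩ K) = B`. In addition, `Nr_F(C) = B` for a finitely generated `k`-subalgebra
`C ⊂ B ∩ K`, and so `B ∩ K = Nr_K(C)` is finitely generated over `k`. The above observation
implies that it suffices to prove the theorem for `F`, `X′` and `FKᵢ`'s instead of the original
`K`, `X` and `Kᵢ`'s, i.e. we can replace the field `K` with a finite purely inseparable extension
and update `X` and `Kᵢ`'s accordingly during the proof."

`InseparableLocalUniformizationDescent.lean` PROVES this transport for the conclusion of
Thm. 1.3.2 (`Temkin2013RelConclusion.of_purelyInseparable`). Here we PROVE it for the conclusion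
of the descent theorem Thm. 4.1.1 (`n = 1`, non-logarithmic), i.e. for the body of
`Temkin2013DescentFor` (`InseparableLocalUniformizationDefect.lean`) with its extra datum, the
finite extension of valued fields `K₁/K`, which is "updated" to `F₁ = FK₁`:

* `Temkin2013DescentConclusion k K O A K₁ O₁` — the conclusion of `Temkin2013DescentFor k K O`
  for the model `X = Spec A` and the valued extension `(K₁, O₁)`, verbatim
  (`temkin2013DescentFor_iff_conclusion` is `Iff.rfl`).
* `Temkin2013DescentConclusion.of_purelyInseparable` — PROVED: if `F/K` is finite purely
  inseparable with `F° = O_F` over `K°`, `A_F ⊆ F` contains the image of `A`, `F₁ = FK₁` is a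
  finite purely inseparable extension of `K₁` generated by `F` with a valuation ring `F₁°`
  over `K₁°`, then the conclusion for `(k, F, F°, Spec A_F, F₁, F₁°)` implies the
  conclusion for `(k, K, K°, Spec A, K₁, K₁°)`. As in the relative case the normalisation
  `B ∩ K = Nr_K(C)` is bypassed: the new model of `K°` is `k[gens of A, qⁿ-th powers of the
  gens of A″]`, whose image in `L₁` has the same integral closure as `A″`.
* `Temkin2013DescentConclusion.of_le` — refining the model is harmless.

## Source

* M. Temkin, *Inseparable local uniformization*, arXiv:0804.1554v3, proof of Thm. 4.1.1, Step 0
  (p. 47).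
-/

noncomputable section

namespace Literature.AlgebraicGeometry.Resolution

universe u

variable {k K : Type u} [Field k] [Field K] [Algebra k K]

/-- The conclusion of Temkin's descent theorem (Thm. 4.1.1, `n = 1`, non-logarithmic; the body of
`Temkin2013DescentFor`) for ONE affine model `X = Spec A` of `K°` and ONE finite extension of
valued fields `(K₁, K₁°)/(K, K°)`: `L₁ = LK₁ ⊇ L ⊇ l` (`l/k`, `L/K` purely inseparable,
`K₁[L] = L₁`), an affine refinement `X′ = Spec A′` of `X` and the valuation ring `L₁°` over `K₁°`
whose centre on `Nr_{L₁}(X′)` is a simple `l`-smooth (regular) point.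
[cite: Temkin2013, Thm. 4.1.1] -/
def Temkin2013DescentConclusion (k K : Type u) [Field k] [Field K] [Algebra k K]
    (O : ValuationSubring K) (A : Subalgebra k K) (K₁ : Type u) [Field K₁] [Algebra K K₁]
    (O₁ : ValuationSubring K₁) : Prop :=
  ∃ (L₁ : Type u) (_ : Field L₁) (_ : Algebra K₁ L₁) (_ : Algebra K L₁) (_ : Algebra k L₁)
    (_ : IsScalarTower K K₁ L₁) (_ : IsScalarTower k K L₁),
    FiniteDimensional K₁ L₁ ∧ IsPurelyInseparable K₁ L₁ ∧
    ∃ l : IntermediateField k L₁, FiniteDimensional k l ∧ IsPurelyInseparable k l ∧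
    ∃ L : IntermediateField K L₁, (l : Set L₁) ⊆ (L : Set L₁) ∧ IsPurelyInseparable K L ∧
      Algebra.adjoin K₁ (L : Set L₁) = ⊤ ∧
    ∃ (A' : Subalgebra k K), A ≤ A' ∧ A'.toSubring ≤ O.toSubring ∧ A'.FG ∧
      IsFractionRing A' K ∧
    ∃ O₁' : ValuationSubring L₁, O₁'.comap (algebraMap K₁ L₁) = O₁ ∧
    ∃ (N : Subalgebra l L₁) (hN : N.toSubring ≤ O₁'.toSubring),
      (N : Set L₁) = {x : L₁ | IsIntegral (A'.map (IsScalarTower.toAlgHom k K L₁)) x} ∧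
      (N.restrictScalars k).FG ∧ IsFractionRing N L₁ ∧
      Algebra.IsSmoothAt l (centreIdeal N O₁' hN) ∧
      Algebra.FormallySmooth l
        (IsLocalRing.ResidueField (Localization.AtPrime (centreIdeal N O₁' hN))) ∧
      IsRegularLocalRing (Localization.AtPrime (centreIdeal N O₁' hN))

/-- `Temkin2013DescentFor` is `Temkin2013DescentConclusion` for all normal affine models and
all finite extensions of valued fields (by definition). [folklore] -/
theorem temkin2013DescentFor_iff_conclusion (O : ValuationSubring K) :
    Temkin2013DescentFor k K O ↔
      ∀ A : Subalgebra k K, A.toSubring ≤ O.toSubring → A.FG → IsFractionRing A K →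
        (∀ x : K, IsIntegral A x → x ∈ A) →
      ∀ (K₁ : Type u) [Field K₁] [Algebra K K₁], FiniteDimensional K K₁ →
      ∀ O₁ : ValuationSubring K₁, O₁.comap (algebraMap K K₁) = O →
        Temkin2013DescentConclusion k K O A K₁ O₁ :=
  Iff.rfl

/-- **Refining the model is harmless** for the descent conclusion (Temkin 2013, proof of
Thm. 4.1.1, Step 0, p. 47: "It suffices to prove the theorem for any affine model of `K°` which
is finer than `X`"). [cite: Temkin2013, proof of Thm. 4.1.1 Step 0 (p. 47)] -/
theorem Temkin2013DescentConclusion.of_le (O : ValuationSubring K) {A A₁ : Subalgebra k K}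
    (hAA₁ : A ≤ A₁) {K₁ : Type u} [Field K₁] [Algebra K K₁] {O₁ : ValuationSubring K₁}
    (h : Temkin2013DescentConclusion k K O A₁ K₁ O₁) :
    Temkin2013DescentConclusion k K O A K₁ O₁ := by
  obtain ⟨L₁, iF, iA1, iA, iAk, iT1, iT2, hfin, hpi, l, hlfin, hlpi, L, hlL, hLpi, hadj,
    A', hA₁A', rest⟩ := h
  exact ⟨L₁, iF, iA1, iA, iAk, iT1, iT2, hfin, hpi, l, hlfin, hlpi, L, hlL, hLpi, hadj,
    A', hAA₁.trans hA₁A', rest⟩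

/-- **Step 0 for the descent theorem: a finite purely inseparable extension of `K` is
harmless** (Temkin 2013, proof of Thm. 4.1.1, Step 0, p. 47: "it suffices to prove the theorem
for `F`, `X′` and `FKᵢ`'s instead of the original `K`, `X` and `Kᵢ`'s"), for `n = 1` and the
non-logarithmic conclusion. Data: `F/K` finite purely inseparable with the valuation ring `O_F`
over `O = K°`; `A_F ⊆ F` any `k`-subalgebra containing the image of the affine model `A` (e.g.
a model of `F°` refining `Nr_F(X)`); the finite valued extension `(K₁, O₁)` of `(K, O)`;
`F₁ = FK₁`, i.e. a field `F₁ ⊇ K₁`, finite purely inseparable, with a compatible embedding of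
`F` such that `K₁[F] = F₁`, and a valuation ring `O₁F` of `F₁` over `O₁` (necessarily the one
over `O_F`, by purely inseparable uniqueness, which is not used). If the
descent conclusion holds for `(k, F, O_F, A_F)` at `(F₁, O₁F)` then it holds for `(k, K, O, A)`
at `(K₁, O₁)`: keep `L₁`, `l`, `L` (restricted to `K`), `L₁°` and `N = Nr_{L₁}(A″)`, and take
as new model of `K°` the ring `k[gens of A, qⁿ-th powers of the gens of A″] ⊆ K`, over whose
image `A″` is integral. PROVED. [cite: Temkin2013, proof of Thm. 4.1.1 Step 0 (p. 47)] -/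
theorem Temkin2013DescentConclusion.of_purelyInseparable (O : ValuationSubring K)
    (A : Subalgebra k K) (hAfg : A.FG) (hAfr : IsFractionRing A K)
    (F : Type u) [Field F] [Algebra K F] [Algebra k F] [IsScalarTower k K F]
    [FiniteDimensional K F] [IsPurelyInseparable K F]
    (O_F : ValuationSubring F) (hO_F : O_F.comap (algebraMap K F) = O)
    (A_F : Subalgebra k F) (hA : ∀ a ∈ A, algebraMap K F a ∈ A_F)
    (K₁ : Type u) [Field K₁] [Algebra K K₁] (O₁ : ValuationSubring K₁)
    (F₁ : Type u) [Field F₁] [Algebra K₁ F₁] [Algebra F F₁] [Algebra K F₁]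
    [IsScalarTower K K₁ F₁] [IsScalarTower K F F₁] [FiniteDimensional K₁ F₁]
    [IsPurelyInseparable K₁ F₁]
    (hgen : Algebra.adjoin K₁ (Set.range (algebraMap F F₁)) = ⊤)
    (O₁F : ValuationSubring F₁) (hO₁F : O₁F.comap (algebraMap K₁ F₁) = O₁)
    (h : Temkin2013DescentConclusion k F O_F A_F F₁ O₁F) :
    Temkin2013DescentConclusion k K O A K₁ O₁ := by
  classical
  obtain ⟨L₁, iF, iA1, iAF, iAk, iT1, iT2, hfin, hpi, l, hlfin, hlpi, L, hlL, hLpi, hadj,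
    A'', hA_FA'', hA''O, hA''fg, hA''fr, O₁', hO₁', N, hN, hNint, hNfg, hNfr, hsm, hsep, hreg⟩ := h
  -- algebra structures on `L₁` over `K₁` and over `K`, and the towers
  letI iK1L : Algebra K₁ L₁ := ((algebraMap F₁ L₁).comp (algebraMap K₁ F₁)).toAlgebra
  haveI : IsScalarTower K₁ F₁ L₁ := IsScalarTower.of_algebraMap_eq fun _ => rfl
  letI iKL : Algebra K L₁ := ((algebraMap F L₁).comp (algebraMap K F)).toAlgebra
  haveI : IsScalarTower K F L₁ := IsScalarTower.of_algebraMap_eq fun _ => rfl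
  haveI : IsScalarTower K K₁ L₁ := IsScalarTower.of_algebraMap_eq fun c => by
    show algebraMap F L₁ (algebraMap K F c) = algebraMap F₁ L₁ (algebraMap K₁ F₁ (algebraMap K K₁ c))
    rw [← IsScalarTower.algebraMap_apply K K₁ F₁, IsScalarTower.algebraMap_apply K F F₁,
      ← IsScalarTower.algebraMap_apply F F₁ L₁]
  haveI : IsScalarTower k K L₁ := IsScalarTower.of_algebraMap_eq fun c => by
    show algebraMap k L₁ c = algebraMap F L₁ (algebraMap K F (algebraMap k K c))
    rw [← IsScalarTower.algebraMap_apply k K F, ← IsScalarTower.algebraMap_apply k F L₁]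
  haveI : IsScalarTower K F₁ L₁ := IsScalarTower.of_algebraMap_eq fun c => by
    show algebraMap F L₁ (algebraMap K F c) = algebraMap F₁ L₁ (algebraMap K F₁ c)
    rw [IsScalarTower.algebraMap_apply K F F₁, ← IsScalarTower.algebraMap_apply F F₁ L₁]
  haveI hfin' : FiniteDimensional K₁ L₁ := Module.Finite.trans F₁ L₁
  have hpi' : IsPurelyInseparable K₁ L₁ := IsPurelyInseparable.trans K₁ F₁ L₁
  -- `qⁿ`-th powers of elements of `F` lie in `K`
  have hpow : ∀ a : F, ∃ n : ℕ, ∃ y : K, algebraMap K F y = a ^ ringExpChar K ^ n := fun a => by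
    obtain ⟨n, y, hy⟩ := IsPurelyInseparable.pow_mem K (ringExpChar K) a
    exact ⟨n, y, hy⟩
  choose n b hb using hpow
  -- generators of `A` and of `A''` (both over `k`)
  obtain ⟨t, ht⟩ := hAfg
  obtain ⟨s, hs⟩ := hA''fg
  have htA : (t : Set K) ⊆ A := by rw [← ht]; exact Algebra.subset_adjoin
  have hsA'' : (s : Set F) ⊆ A'' := by rw [← hs]; exact Algebra.subset_adjoin
  -- the new affine model `X' = Spec A'` of `K°`
  set A' : Subalgebra k K := Algebra.adjoin k (↑t ∪ b '' ↑s) with hA'def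
  have hA'fg : A'.FG := by
    refine ⟨t ∪ s.image b, ?_⟩
    rw [Finset.coe_union, Finset.coe_image]
  have hAA' : A ≤ A' := by
    rw [← ht]; exact Algebra.adjoin_mono Set.subset_union_left
  have hA'A'' : ∀ x ∈ A', algebraMap K F x ∈ A'' := by
    have hle : A' ≤ A''.comap (IsScalarTower.toAlgHom k K F) := by
      refine Algebra.adjoin_le ?_
      rintro y (hy | ⟨a, ha, rfl⟩)
      · simpa using hA_FA'' (hA y (htA hy))
      · simpa [hb] using pow_mem (hsA'' ha) (ringExpChar K ^ n a)
    intro x hx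
    simpa using hle hx
  have hA'O : A'.toSubring ≤ O.toSubring := by
    intro x hx
    have hxF : algebraMap K F x ∈ O_F := hA''O (hA'A'' x hx)
    rw [← hO_F]
    exact hxF
  have hA'fr : IsFractionRing A' K := by
    haveI := hAfr
    refine IsFractionRing.of_field A' K fun z => ?_
    obtain ⟨x, y, hy, rfl⟩ := IsFractionRing.div_surjective (A := A) z
    exact ⟨⟨x, hAA' x.2⟩, ⟨y, hAA' y.2⟩, rfl⟩
  -- the images of `A'` and `A''` in `L₁` have the same integral closure
  set S₁ : Subalgebra k L₁ := A'.map (IsScalarTower.toAlgHom k K L₁) with hS₁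
  set S₂ : Subalgebra k L₁ := A''.map (IsScalarTower.toAlgHom k F L₁) with hS₂
  have h12 : S₁.toSubring ≤ S₂.toSubring := by
    intro z hz
    obtain ⟨x, hx, rfl⟩ := Subalgebra.mem_map.mp hz
    exact Subalgebra.mem_map.mpr ⟨algebraMap K F x, hA'A'' x hx, rfl⟩
  have key : ∀ w ∈ Algebra.adjoin k (s : Set F), IsIntegral S₁ (algebraMap F L₁ w) := by
    intro w hw
    induction hw using Algebra.adjoin_induction with
    | mem x hx =>
      refine IsIntegral.of_pow (expChar_pow_pos K (ringExpChar K) (n x)) ?_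
      have hmem : algebraMap K L₁ (b x) ∈ S₁ :=
        Subalgebra.mem_map.mpr ⟨b x, Algebra.subset_adjoin (Or.inr ⟨x, hx, rfl⟩), rfl⟩
      have hpw : algebraMap F L₁ x ^ ringExpChar K ^ n x = algebraMap K L₁ (b x) := by
        rw [← map_pow, ← hb]; rfl
      rw [hpw]
      exact isIntegral_algebraMap (x := (⟨_, hmem⟩ : S₁))
    | algebraMap r =>
      rw [← IsScalarTower.algebraMap_apply k F L₁]
      exact isIntegral_algebraMap (R := S₁) (x := algebraMap k S₁ r)
    | add x y _ _ hx hy => simpa only [map_add] using hx.add hy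
    | mul x y _ _ hx hy => simpa only [map_mul] using hx.mul hy
  have hint : ∀ z ∈ S₂, IsIntegral S₁ z := by
    intro z hz
    obtain ⟨w, hw, rfl⟩ := Subalgebra.mem_map.mp hz
    exact key w (by rw [hs]; exact hw)
  have hNint' : (N : Set L₁) = {x : L₁ | IsIntegral S₁ x} := by
    rw [hNint]
    ext x
    exact ⟨fun hx => isIntegral_of_le_of_forall_isIntegral S₁ S₂ h12 hint hx,
      fun hx => isIntegral_of_subalgebra_le S₁ S₂ h12 hx⟩
  -- the valuation ring `L₁°` restricts to `K₁°`
  have hO₁'' : O₁'.comap (algebraMap K₁ L₁) = O₁ := by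
    show O₁'.comap ((algebraMap F₁ L₁).comp (algebraMap K₁ F₁)) = O₁
    rw [← ValuationSubring.comap_comap, hO₁', hO₁F]
  -- `L` as an intermediate field of `L₁/K`
  let L' : IntermediateField K L₁ := L.restrictScalars K
  have hlL' : (l : Set L₁) ⊆ (L' : Set L₁) := hlL
  have hL'pi : IsPurelyInseparable K L' := by
    rw [isPurelyInseparable_iff_pow_mem K (ringExpChar K)]
    rintro ⟨x, hx⟩
    -- `x ∈ L`, `L/F` purely inseparable, `F/K` purely inseparable
    haveI : ExpChar F (ringExpChar K) :=
      expChar_of_injective_algebraMap (algebraMap K F).injective _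
    obtain ⟨m₁, y, hy⟩ := IsPurelyInseparable.pow_mem F (ringExpChar K) (⟨x, hx⟩ : L)
    obtain ⟨m₂, z, hz⟩ := IsPurelyInseparable.pow_mem K (ringExpChar K) y
    refine ⟨m₁ + m₂, z, Subtype.ext ?_⟩
    have hy' : algebraMap F L₁ y = x ^ ringExpChar K ^ m₁ := by
      have := congrArg (fun w : L => (w : L₁)) hy
      simpa using this
    change algebraMap K L₁ z = x ^ ringExpChar K ^ (m₁ + m₂)
    rw [IsScalarTower.algebraMap_apply K F L₁, hz, map_pow, hy', ← pow_mul, ← pow_add, add_comm]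
  -- `K₁[L] = L₁`
  have hFL : ∀ f : F, algebraMap F L₁ f ∈ Algebra.adjoin K₁ (L' : Set L₁) := fun f =>
    Algebra.subset_adjoin (show algebraMap F L₁ f ∈ L from L.algebraMap_mem f)
  have hF₁L : ∀ f₁ : F₁, algebraMap F₁ L₁ f₁ ∈ Algebra.adjoin K₁ (L' : Set L₁) := by
    intro f₁
    have hf₁ : f₁ ∈ Algebra.adjoin K₁ (Set.range (algebraMap F F₁)) := by
      rw [hgen]; exact Algebra.mem_top
    induction hf₁ using Algebra.adjoin_induction with
    | mem x hx =>
      obtain ⟨f, rfl⟩ := hx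
      rw [← IsScalarTower.algebraMap_apply F F₁ L₁]
      exact hFL f
    | algebraMap c =>
      rw [← IsScalarTower.algebraMap_apply K₁ F₁ L₁]
      exact Subalgebra.algebraMap_mem _ c
    | add x y _ _ hx hy => rw [map_add]; exact Subalgebra.add_mem _ hx hy
    | mul x y _ _ hx hy => rw [map_mul]; exact Subalgebra.mul_mem _ hx hy
  have hadj' : Algebra.adjoin K₁ (L' : Set L₁) = ⊤ := by
    rw [eq_top_iff]
    rintro x -
    have hx : x ∈ Algebra.adjoin F₁ (L : Set L₁) := by rw [hadj]; exact Algebra.mem_top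
    induction hx using Algebra.adjoin_induction with
    | mem y hy => exact Algebra.subset_adjoin hy
    | algebraMap c => exact hF₁L c
    | add y z _ _ hy hz => exact Subalgebra.add_mem _ hy hz
    | mul y z _ _ hy hz => exact Subalgebra.mul_mem _ hy hz
  exact ⟨L₁, iF, iK1L, iKL, iAk, inferInstance, inferInstance, hfin', hpi', l, hlfin, hlpi,
    L', hlL', hL'pi, hadj', A', hAA', hA'O, hA'fg, hA'fr, O₁', hO₁'', N, hN, hNint', hNfg, hNfr,
    hsm, hsep, hreg⟩

end Literature.AlgebraicGeometry.Resolution
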